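import Summits.CriticalPhenomena.PercolationContinuityZ3.Theorems.PercNearOneGluingNoHeavyQuantFarSunLargeK
import HarnessLib

/-!
# FAR beyond trees: every layer of FAR on all hairy cycles with **`K ≥ 1600·j + 81`** hairs — the threshold of
# `HairyCycle.sunFAR_of_largeK` made LINEAR in the layer

builds on p205010 (kernel theorem, internal audit signed; external expert review pending)

Support file (`--supports stmt-CriticalPhenomena-4575`), seat `prim-cert-1` (gen 41); memo `prim-cert-1/FROM-prim-cert-1-g41-ALL-LAYERS.md` §3.
`…QuantFarSunLargeK` proves `SunFAR K j` for `(64·2^j+2)² ≤ j·K` — exponential in `j` only because its numeric step bounds `e^{Σ/2}` by the FIXED Taylor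
term `(Σ/2)⁴/24`.  Using instead `e^{Σ/2} = (e^{Σ/(2n)})^n ≥ (1 + Σ/(2n))^n ≥ (Σ/(2n))^n` with `n = j + 3` (`Real.add_one_le_exp`) the same charging argument
works from `Σ ≥ 40j`, and LEMMA 2_j (`jK < (Σ+1)²` on `R_j`) turns this into `K ≥ 1600j + 81`:
* `HairyCycle.exp_ge_div_pow` — `(x/n)^n ≤ e^x` (`x ≥ 0`, `n ≥ 1`);
* `HairyCycle.largeK_numeric_linear` — for `2 ≤ j`, `40j ≤ S`:  `4(S+1)²·2^{2j+1}·e^{−S/2} ≤ j(S − 6j − 2)`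
  (`(S+1)² ≤ 2S²`, `S − 6j − 2 ≥ S/2`, `(2(j+3))^{j+3} ≤ (5j)^{j+3}`, and `4000·20^j ≤ 1600·40^j`);
* `HairyCycle.witGavg_ge_one_of_numeric` — LEMMA 1_j with the numeric inequality as a HYPOTHESIS (the charging assembly of `witGavg_ge_one_largeK` verbatim);
* **`HairyCycle.sunFAR_of_ge_linear`** — for `j ≥ 2` and `1600·j + 81 ≤ K`:  `SunFAR K j`.
No definitions, no sorries, standard axioms.  [this work]
[cite: KozmaNitzan2024, Conjecture 3 (p. 15)] (context: the lower-tail family FAR serves).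
-/

noncomputable section

namespace Summit.CriticalPhenomena.PercolationContinuityZ3.Theorems.HairyCycle

open Finset
open scoped Classical

variable {K : ℕ}

/-! ## `e^x ≥ (x/n)^n` -/

/-- `(x/n)^n ≤ e^x` for `x ≥ 0` and `n ≥ 1` (from `1 + y ≤ e^y`). [folklore] -/
theorem exp_ge_div_pow {x : ℝ} (hx : 0 ≤ x) {n : ℕ} (hn : 1 ≤ n) : (x / n) ^ n ≤ Real.exp x := by
  have hn0 : (0 : ℝ) < n := by exact_mod_cast (show 0 < n by omega)
  have h1 : x / n ≤ x / n + 1 := by linarith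
  have h2 : x / n + 1 ≤ Real.exp (x / n) := Real.add_one_le_exp _
  have h3 : (x / n) ^ n ≤ Real.exp (x / n) ^ n := pow_le_pow_left₀ (div_nonneg hx hn0.le) (h1.trans h2) n
  have h4 : Real.exp (x / n) ^ n = Real.exp x := by
    rw [← Real.exp_nat_mul]; congr 1; field_simp
  rw [h4] at h3
  exact h3

/-! ## The numeric inequality, linear threshold -/

/-- **Numeric core, linear threshold**: for `2 ≤ j` and `40j ≤ S`:  `4(S+1)²·2^{2j+1}·e^{−S/2} ≤ j·(S − 6j − 2)`. [this work] -/
theorem largeK_numeric_linear {j : ℕ} (hj : 2 ≤ j) {S : ℝ} (hS : 40 * (j : ℝ) ≤ S) :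
    4 * (S + 1) ^ 2 * (2 : ℝ) ^ (2 * j + 1) * Real.exp (-(S / 2)) ≤ j * (S - 6 * j - 2) := by
  have hj2 : (2 : ℝ) ≤ j := by exact_mod_cast hj
  have hS80 : 80 ≤ S := by linarith
  have hS0 : 0 < S := by linarith
  set n : ℕ := j + 3 with hndef
  have hn1 : 1 ≤ n := by omega
  have hnR : (n : ℝ) = j + 3 := by rw [hndef]; push_cast; ring
  have hn0 : (0 : ℝ) < n := by rw [hnR]; linarith
  -- `e^{S/2} ≥ (S/(2n))^n`, so `e^{−S/2} · S^n ≤ (2n)^n`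
  have hexp : (S / 2 / n) ^ n ≤ Real.exp (S / 2) := exp_ge_div_pow (by linarith) hn1
  have hexp' : Real.exp (-(S / 2)) * S ^ n ≤ (2 * (n : ℝ)) ^ n := by
    rw [Real.exp_neg]
    have hpos : 0 < Real.exp (S / 2) := Real.exp_pos _
    rw [inv_mul_le_iff₀ hpos]
    have e : (S / 2 / n) ^ n = S ^ n / (2 * (n : ℝ)) ^ n := by rw [← div_pow]; congr 1; field_simp
    rw [e, div_le_iff₀ (by positivity)] at hexp
    linarith
  -- `(2n)^n ≤ (5j)^n` and `n = j + 3`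
  have h2n : (2 * (n : ℝ)) ^ n ≤ (5 * (j : ℝ)) ^ n := pow_le_pow_left₀ (by positivity) (by rw [hnR]; linarith) n
  -- main polynomial inequality: `32 · 4^j · (5j)^{j+3} ≤ j · S^{j+2}`
  have hS40 : (40 * (j : ℝ)) ^ (j + 2) ≤ S ^ (j + 2) := pow_le_pow_left₀ (by positivity) hS (j + 2)
  have hj0 : (0 : ℝ) < j := by linarith
  have hpoly : 32 * (4 : ℝ) ^ j * (5 * (j : ℝ)) ^ (j + 3) ≤ j * S ^ (j + 2) := by
    -- `32·4^j·(5j)^{j+3} = 4000·20^j·j^{j+3}` and `j·(40j)^{j+2} = 1600·40^j·j^{j+3}`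
    have e1 : 32 * (4 : ℝ) ^ j * (5 * (j : ℝ)) ^ (j + 3) = 4000 * (20 : ℝ) ^ j * (j : ℝ) ^ (j + 3) := by
      rw [mul_pow, pow_add, pow_add, show (20 : ℝ) = 4 * 5 by norm_num, mul_pow]; ring
    have e2 : (j : ℝ) * (40 * (j : ℝ)) ^ (j + 2) = 1600 * (40 : ℝ) ^ j * (j : ℝ) ^ (j + 3) := by
      rw [mul_pow, pow_add, pow_add]; ring
    have h20 : (20 : ℝ) ^ j ≤ (40 : ℝ) ^ j := pow_le_pow_left₀ (by norm_num) (by norm_num) j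
    have h2j : (2.5 : ℝ) ≤ (2 : ℝ) ^ j := by
      have : (2 : ℝ) ^ 2 ≤ (2 : ℝ) ^ j := pow_le_pow_right₀ (by norm_num) hj
      nlinarith
    have h40 : (40 : ℝ) ^ j = (20 : ℝ) ^ j * (2 : ℝ) ^ j := by rw [← mul_pow]; norm_num
    have hjpow : 0 < (j : ℝ) ^ (j + 3) := by positivity
    have h20pos : 0 < (20 : ℝ) ^ j := by positivity
    have key : 4000 * (20 : ℝ) ^ j ≤ 1600 * (40 : ℝ) ^ j := by rw [h40]; nlinarith
    calc 32 * (4 : ℝ) ^ j * (5 * (j : ℝ)) ^ (j + 3) = 4000 * (20 : ℝ) ^ j * (j : ℝ) ^ (j + 3) := e1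
      _ ≤ 1600 * (40 : ℝ) ^ j * (j : ℝ) ^ (j + 3) := mul_le_mul_of_nonneg_right key hjpow.le
      _ = (j : ℝ) * (40 * (j : ℝ)) ^ (j + 2) := e2.symm
      _ ≤ j * S ^ (j + 2) := mul_le_mul_of_nonneg_left hS40 hj0.le
  -- assemble: multiply the goal by `S^n = S^{j+3} > 0`
  have hSn : 0 < S ^ n := by positivity
  have hgoal : 4 * (S + 1) ^ 2 * (2 : ℝ) ^ (2 * j + 1) * Real.exp (-(S / 2)) * S ^ n ≤ j * (S - 6 * j - 2) * S ^ n := by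
    have e3 : (2 : ℝ) ^ (2 * j + 1) = 2 * (4 : ℝ) ^ j := by
      rw [pow_succ, pow_mul]; norm_num; ring
    have hA : 4 * (S + 1) ^ 2 * (2 : ℝ) ^ (2 * j + 1) * Real.exp (-(S / 2)) * S ^ n ≤
        4 * (S + 1) ^ 2 * (2 * (4 : ℝ) ^ j) * (5 * (j : ℝ)) ^ n := by
      rw [e3]
      have hc : 0 ≤ 4 * (S + 1) ^ 2 * (2 * (4 : ℝ) ^ j) := by positivity
      calc 4 * (S + 1) ^ 2 * (2 * (4 : ℝ) ^ j) * Real.exp (-(S / 2)) * S ^ n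
          = 4 * (S + 1) ^ 2 * (2 * (4 : ℝ) ^ j) * (Real.exp (-(S / 2)) * S ^ n) := by ring
        _ ≤ 4 * (S + 1) ^ 2 * (2 * (4 : ℝ) ^ j) * (5 * (j : ℝ)) ^ n := mul_le_mul_of_nonneg_left (hexp'.trans h2n) hc
    -- `(S+1)² ≤ 2S²`, `(5j)^n = (5j)^{j+3}`, `S − 6j − 2 ≥ S/2`, `S^n = S^{j+2}·S`
    have hB : 4 * (S + 1) ^ 2 * (2 * (4 : ℝ) ^ j) * (5 * (j : ℝ)) ^ n ≤ 16 * S ^ 2 * (4 : ℝ) ^ j * (5 * (j : ℝ)) ^ (j + 3) := by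
      rw [hndef]
      have h1 : (S + 1) ^ 2 ≤ 2 * S ^ 2 := by nlinarith
      have h2 : 0 ≤ (4 : ℝ) ^ j * (5 * (j : ℝ)) ^ (j + 3) := by positivity
      nlinarith
    have hC : 16 * S ^ 2 * (4 : ℝ) ^ j * (5 * (j : ℝ)) ^ (j + 3) ≤ j * (S - 6 * j - 2) * S ^ n := by
      rw [hndef]
      have h1 : S / 2 ≤ S - 6 * j - 2 := by linarith
      have e4 : S ^ (j + 3) = S ^ (j + 2) * S := by rw [pow_succ]
      rw [e4]
      -- `16 S² 4^j (5j)^{j+3} = (S²/2)·(32·4^j(5j)^{j+3}) ≤ (S²/2)·(j S^{j+2}) ≤ j (S−6j−2) S^{j+2} S`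
      have h3 : 16 * S ^ 2 * (4 : ℝ) ^ j * (5 * (j : ℝ)) ^ (j + 3) ≤ (S ^ 2 / 2) * (j * S ^ (j + 2)) := by
        have := mul_le_mul_of_nonneg_left hpoly (show 0 ≤ S ^ 2 / 2 by positivity)
        linarith
      have h4 : (S ^ 2 / 2) * (j * S ^ (j + 2)) ≤ j * (S - 6 * j - 2) * (S ^ (j + 2) * S) := by
        have hp : 0 ≤ (j : ℝ) * S ^ (j + 2) * S := by positivity
        nlinarith
      linarith
    linarith
  exact le_of_mul_le_mul_right hgoal hSn

/-! ## LEMMA 1 with the numeric inequality as a hypothesis -/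

/-- **LEMMA 1 at layer `j ≥ 1`, numeric step abstracted**: if `0 < h ≤ 1` on `range K`, `Σ > 0`,
`4(Σ+1)²·2^{2j+1}·e^{−Σ/2} ≤ j(Σ − 6j − 2)` and `j·K < (Σ+1)²`, then `witGavg K h j ≥ 1` (the charging assembly of `witGavg_ge_one_largeK`). [this work] -/
theorem witGavg_ge_one_of_numeric {h : ℕ → ℝ} (hh : ∀ k, k < K → 0 < h k ∧ h k ≤ 1) {j : ℕ} (hj : 1 ≤ j)
    (hSpos : 0 < ∑ k ∈ range K, h k)
    (hnum : 4 * ((∑ k ∈ range K, h k) + 1) ^ 2 * (2 : ℝ) ^ (2 * j + 1) * Real.exp (-((∑ k ∈ range K, h k) / 2)) ≤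
      j * ((∑ k ∈ range K, h k) - 6 * j - 2))
    (hjK : (j : ℝ) * K < (∑ k ∈ range K, h k + 1) ^ 2) :
    1 ≤ witGavg K h j := by
  have hh' : ∀ k, k < K → 0 ≤ h k ∧ h k ≤ 1 := fun k hk => ⟨(hh k hk).1.le, (hh k hk).2⟩
  set S := ∑ k ∈ range K, h k with hSdef
  have hj0 : (0 : ℝ) < j := by exact_mod_cast (show 0 < j by omega)
  -- `P := P(T ≤ 2j+1) ≤ 2^{2j+1} e^{−S/2}`
  set P := ∑ Q ∈ (range K).powerset, hairW K h Q * (if (Q ∩ range K).card ≤ 2 * j + 1 then (1 : ℝ) else 0) with hPdef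
  have hP0 : 0 ≤ P := Finset.sum_nonneg fun Q _ => mul_nonneg (hairW_nonneg hh' Q) (by split_ifs <;> norm_num)
  have hPbound : P ≤ (2 : ℝ) ^ (2 * j + 1) * Real.exp (-(S / 2)) := by
    have hc := pow_mul_sum_hairW_count_le_exp hh' (range K) (2 * j + 1) (θ := 1 / 2) (by norm_num) (by norm_num)
    have hfilt : (range K).filter (fun k => k ∈ range K) = range K := by ext k; simp
    rw [hfilt, ← hSdef, ← hPdef] at hc
    have e : -(1 - 1 / 2) * S = -(S / 2) := by ring
    rw [e] at hc
    have h2 : (2 : ℝ) ^ (2 * j + 1) * ((1 / 2 : ℝ) ^ (2 * j + 1) * P) = P := by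
      rw [← mul_assoc, ← mul_pow]; norm_num
    calc P = (2 : ℝ) ^ (2 * j + 1) * ((1 / 2 : ℝ) ^ (2 * j + 1) * P) := h2.symm
      _ ≤ (2 : ℝ) ^ (2 * j + 1) * Real.exp (-(S / 2)) := mul_le_mul_of_nonneg_left hc (by positivity)
  -- hence `4 K P ≤ S − 6j − 2`
  have hK0 : (0 : ℝ) ≤ K := Nat.cast_nonneg K
  have h4KP : 4 * K * P ≤ S - 6 * j - 2 := by
    have h1 : 4 * K * P ≤ 4 * K * ((2 : ℝ) ^ (2 * j + 1) * Real.exp (-(S / 2))) :=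
      mul_le_mul_of_nonneg_left hPbound (by positivity)
    set B := (2 : ℝ) ^ (2 * j + 1) * Real.exp (-(S / 2)) with hBdef
    have hBpos : 0 ≤ B := by positivity
    have h2 : (j : ℝ) * (4 * K * B) ≤ 4 * (S + 1) ^ 2 * B := by
      have := mul_le_mul_of_nonneg_right hjK.le hBpos
      nlinarith
    have hnum' : 4 * (S + 1) ^ 2 * B ≤ j * (S - 6 * j - 2) := by
      have e : 4 * (S + 1) ^ 2 * B = 4 * (S + 1) ^ 2 * (2 : ℝ) ^ (2 * j + 1) * Real.exp (-(S / 2)) := by rw [hBdef]; ring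
      rw [e]; exact hnum
    have h1' : (j : ℝ) * (4 * K * P) ≤ j * (4 * K * B) := mul_le_mul_of_nonneg_left h1 hj0.le
    have h3 : (j : ℝ) * (4 * K * P) ≤ j * (S - 6 * j - 2) := h1'.trans (h2.trans hnum')
    exact le_of_mul_le_mul_left h3 hj0
  -- central positions (threshold `2j`)
  set Cen := (range K).filter (fun k => (2 * j : ℝ) ≤ ∑ i ∈ range k, h i ∧ (2 * j : ℝ) ≤ ∑ i ∈ (range K).filter (fun i => k < i), h i)
    with hCendef
  have hCen := card_central_gt_gen hh' (M := (2 * j : ℝ)) (by positivity)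
  rw [← hSdef, ← hCendef] at hCen
  -- the case `P = 0`: no deficit at all (mass = 1, boost ≥ 0)
  rcases eq_or_lt_of_le hP0 with hz | hPpos
  · rw [witGavg_eq_mass_add_boost (fun k hk => (hh k hk).1) j]
    have hmass : ∑ Q ∈ (range K).powerset, hairW K h Q * (if (wit j Q).Nonempty then (1 : ℝ) else 0) = 1 := by
      have hdef : ∑ Q ∈ (range K).powerset, hairW K h Q * (if (wit j Q).Nonempty then (0 : ℝ) else 1) ≤ P := by
        refine Finset.sum_le_sum fun Q hQ => mul_le_mul_of_nonneg_left ?_ (hairW_nonneg hh' Q)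
        rw [Finset.mem_powerset] at hQ
        split_ifs with h1 h2
        · norm_num
        · norm_num
        · norm_num
        · exfalso
          have := (Finset.card_le_card (Finset.inter_subset_left (s₁ := Q) (s₂ := range K))).trans (card_le_of_wit_not_nonempty h1)
          omega
      have hdef0 : 0 ≤ ∑ Q ∈ (range K).powerset, hairW K h Q * (if (wit j Q).Nonempty then (0 : ℝ) else 1) :=
        Finset.sum_nonneg fun Q _ => mul_nonneg (hairW_nonneg hh' Q) (by split_ifs <;> norm_num)
      have htot : ∑ Q ∈ (range K).powerset, hairW K h Q * (if (wit j Q).Nonempty then (1 : ℝ) else 0) +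
          ∑ Q ∈ (range K).powerset, hairW K h Q * (if (wit j Q).Nonempty then (0 : ℝ) else 1) = 1 := by
        rw [← Finset.sum_add_distrib]
        calc ∑ Q ∈ (range K).powerset, (hairW K h Q * (if (wit j Q).Nonempty then (1 : ℝ) else 0) +
                hairW K h Q * (if (wit j Q).Nonempty then (0 : ℝ) else 1))
            = ∑ Q ∈ (range K).powerset, hairW K h Q := Finset.sum_congr rfl fun Q _ => by split_ifs <;> ring
          _ = 1 := sum_hairW_eq_one h
      linarith
    have hboost : 0 ≤ ∑ k ∈ range K, ∑ Q ∈ ((range K).erase k).powerset, hairW K h Q * witAvgKernel j (insert k Q) k :=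
      Finset.sum_nonneg fun k _ => Finset.sum_nonneg fun Q _ => mul_nonneg (hairW_nonneg hh' Q) (by
        unfold witAvgKernel; split_ifs
        · exact div_nonneg zero_le_one (Nat.cast_nonneg _)
        · exact le_rfl)
    linarith
  -- the charging criterion with unit weights on `Cen` and `Ω₀ = 4 K P`
  have hKpos : (0 : ℝ) < K := by
    rcases Nat.eq_zero_or_pos K with hK0' | hK0'
    · exfalso
      rw [hK0'] at hSdef
      have : S = 0 := by rw [hSdef, Finset.range_zero, Finset.sum_empty]
      linarith
    · exact_mod_cast hK0'
  have hΩ : 0 < 4 * K * P := by positivity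
  refine witGavg_ge_one_of_charging hh j (fun k => if k ∈ Cen then 1 else 0) hΩ (fun H hH hne => ?_) (fun k hk => ?_)
  · -- cover: `4KP ≤ #(Cen ∖ H)`
    have hHc : H.card ≤ 2 * j := card_le_of_wit_not_nonempty hne
    have hsum : ∑ k ∈ range K \ H, (if k ∈ Cen then (1 : ℝ) else 0) = (((range K \ H).filter (fun k => k ∈ Cen)).card : ℝ) := by
      rw [Finset.sum_boole]
    rw [hsum]
    have hsub : Cen \ H ⊆ (range K \ H).filter (fun k => k ∈ Cen) := by
      intro k hk
      rw [Finset.mem_sdiff] at hk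
      exact Finset.mem_filter.2 ⟨Finset.mem_sdiff.2 ⟨(Finset.mem_filter.1 hk.1).1, hk.2⟩, hk.1⟩
    have hc1 : ((Cen \ H).card : ℝ) ≤ (((range K \ H).filter (fun k => k ∈ Cen)).card : ℝ) := by
      exact_mod_cast Finset.card_le_card hsub
    have hc2 : (Cen.card : ℝ) - 2 * j ≤ ((Cen \ H).card : ℝ) := by
      have h' : Cen.card - H.card ≤ (Cen \ H).card := Finset.le_card_sdiff H Cen
      have h2j : (H.card : ℝ) ≤ 2 * j := by exact_mod_cast hHc
      have : (Cen.card : ℝ) - (H.card : ℝ) ≤ ((Cen.card - H.card : ℕ) : ℝ) := by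
        rcases le_or_gt H.card Cen.card with hle | hgt
        · rw [Nat.cast_sub hle]
        · rw [Nat.sub_eq_zero_of_le hgt.le]; push_cast; linarith [(Nat.cast_lt (α := ℝ)).2 hgt]
      have h'' : ((Cen.card - H.card : ℕ) : ℝ) ≤ ((Cen \ H).card : ℝ) := by exact_mod_cast h'
      linarith
    linarith
  · -- comparison: `ω_k d_k ≤ 4KP · a_k`
    have ha0 : 0 ≤ ∑ Q ∈ ((range K).erase k).powerset, hairW K h Q * witAvgKernel j (insert k Q) k :=
      Finset.sum_nonneg fun Q _ => mul_nonneg (hairW_nonneg hh' Q) (by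
        unfold witAvgKernel; split_ifs
        · exact div_nonneg zero_le_one (Nat.cast_nonneg _)
        · exact le_rfl)
    by_cases hkC : k ∈ Cen
    · rw [if_pos hkC, one_mul]
      have hkC' := hkC
      rw [hCendef, Finset.mem_filter] at hkC'
      -- `d_k = (1 − h k)·D⁰_k ≤ (1 − h k)·P`
      have hd : ∑ Q ∈ ((range K).erase k).powerset, hairW K h Q * (if (wit j Q).Nonempty then (0 : ℝ) else 1) =
          (1 - h k) * ∑ Q ∈ ((range K).erase k).powerset, hairW K (Function.update h k 0) Q * (if (wit j Q).Nonempty then (0 : ℝ) else 1) := by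
        rw [Finset.mul_sum]
        refine Finset.sum_congr rfl fun Q hQ => ?_
        rw [Finset.mem_powerset] at hQ
        rw [hairW_eq_mul_erase h hk (fun hm => Finset.notMem_erase k _ (hQ hm))]
        ring
      have hPk := noWit_erase_le_gen hh' j hk
      rw [← hPdef] at hPk
      have ha := boost_ge_quarter_div hh' hj hk hkC'.2.1 hkC'.2.2
      have hu : 0 ≤ 1 - h k := by linarith [(hh k hk).2]
      rw [hd]
      calc (1 - h k) * ∑ Q ∈ ((range K).erase k).powerset,
            hairW K (Function.update h k 0) Q * (if (wit j Q).Nonempty then (0 : ℝ) else 1)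
          ≤ (1 - h k) * P := mul_le_mul_of_nonneg_left hPk hu
        _ = 4 * K * P * ((1 - h k) / (4 * K)) := by field_simp
        _ ≤ 4 * K * P * ∑ Q ∈ ((range K).erase k).powerset, hairW K h Q * witAvgKernel j (insert k Q) k :=
            mul_le_mul_of_nonneg_left ha hΩ.le
    · rw [if_neg hkC, zero_mul]
      exact mul_nonneg hΩ.le ha0


/-! ## The theorem with a linear threshold -/

/-- **EVERY LAYER OF FAR ON ALL HAIRY CYCLES WITH `K ≥ 1600·j + 81` HAIRS.**  For every layer `j ≥ 2` and every `K ≥ 1600 j + 81`:  `SunFAR K j`. [this work] -/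
theorem sunFAR_of_ge_linear {j : ℕ} (hj : 2 ≤ j) {K : ℕ} (hK : 1600 * j + 81 ≤ K) : SunFAR K j := by
  have hj1 : 1 ≤ j := le_trans (by norm_num) hj
  have hK2 : 2 ≤ K := by omega
  refine sunFAR_of_witGavg_from_all hj K hK2 (fun K' hK' h hh m hm hmin hS2j hR => ?_) K le_rfl
  -- truncate `h` outside `range K'`
  set h' : ℕ → ℝ := fun k => if k < K' then h k else 0 with hh'def
  have he : ∀ k, k < K' → h' k = h k := fun k hk => by rw [hh'def]; simp only [hk, if_true]
  have hh' : ∀ k, 0 ≤ h' k ∧ h' k ≤ 1 := by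
    intro k
    by_cases hk : k < K'
    · rw [he k hk]; exact hh k hk
    · rw [hh'def]; simp only [hk, if_false]; norm_num
  have hsum : ∑ k ∈ range K', h' k = ∑ k ∈ range K', h k :=
    Finset.sum_congr rfl fun k hk => he k (Finset.mem_range.1 hk)
  have hF : hairV K' h' j (range K') = hairV K' h j (range K') := hairV_congr he j (range K')
  have hL2 := jK_lt_of_R (K := K') hh' hj1 hm (fun k hk => by rw [he m hm, he k hk]; exact hmin k hk)
    (by rw [hsum]; exact hS2j) (by rw [hsum, hF, he m hm]; exact hR)
  rw [hsum, he m hm] at hL2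
  obtain ⟨hjK, hηpos⟩ := hL2
  set S := ∑ k ∈ range K', h k with hSdef
  -- `S ≥ 40j` from `(40j+1)² ≤ j(1600j+81) ≤ jK ≤ jK' < (S+1)²`
  have hj2 : (2 : ℝ) ≤ j := by exact_mod_cast hj
  have hbound : (40 * (j : ℝ) + 1) ^ 2 < (S + 1) ^ 2 := by
    have h1 : 1600 * j + 81 ≤ K' := hK.trans hK'
    have h2 : ((1600 * j + 81 : ℕ) : ℝ) ≤ (K' : ℝ) := by exact_mod_cast h1
    push_cast at h2
    have hj0 : (0 : ℝ) ≤ j := by linarith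
    nlinarith
  have hS : 40 * (j : ℝ) ≤ S := by
    have hS0 : 0 ≤ S := Finset.sum_nonneg fun k hk => (hh k (Finset.mem_range.1 hk)).1
    have hlt : 40 * (j : ℝ) + 1 < S + 1 := lt_of_pow_lt_pow_left₀ 2 (by linarith) hbound
    linarith
  have hSpos : 0 < S := by linarith
  have hhpos : ∀ k, k < K' → 0 < h k ∧ h k ≤ 1 := fun k hk => ⟨lt_of_lt_of_le hηpos (hmin k hk), (hh k hk).2⟩
  exact witGavg_ge_one_of_numeric hhpos hj1 hSpos (largeK_numeric_linear hj hS) hjK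

end Summit.CriticalPhenomena.PercolationContinuityZ3.Theorems.HairyCycle

end
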